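import Summits.QuantumAdvantage.QuantumAdvantage.Statement
import Mathlib.Algebra.Order.BigOperators.Group.Finset
import Mathlib.Data.Real.Basic
import Mathlib.Data.Fintype.Card
import Mathlib.Tactic.Linarith
import Mathlib.Tactic.Push
import HarnessLib

/-!
# The light walk and the offline greedy: combinatorial core of the type-2 `P = BPP` base oracle

Solo/blind wall, rider (α) on Q11 (v16, prose: `paper/generic-rung.md` §6.6, working file
`work/s16/greedy-defeat.md`). THEOREM H of the wall builds an oracle `B` with `P^B = BPP^B` above
which the type-2 (equivalently: Cohen-generic-extension) separation `P ≠ BPP` holds, so that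
"`P = BPP` implies type-2 `P = BPP`" — the step from rung IV to rung III½ of the wall's ladder —
has no relativizing proof. Its one non-bookkeeping step is the *Defeat Lemma*: a deterministic
simulator `N` that may rename ("junk") polynomially many list coordinates of the hidden anchored
structure and may read the `CODE` rows of bounded-error-total probabilistic machines is answered,
for every row, with the machine's *side* (rounded acceptance) at the ALL-junked world; after `N`
halts, the constructor must exhibit a final junk set `J ⊇ T` (`T` = the coordinates `N` touched)
of polynomial size at which every answered side agrees with the side at the all-junked world.

Everything analytic about that step is packaged into three hypotheses on abstract data — a finite
type `ι` of coordinates, a finite type `κ` of answered machine/input pairs, an acceptance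
function `acc : κ → Finset ι → ℝ` (acceptance of pair `k` when exactly the coordinates in the
pattern are junked) and effective weights `W : κ → Finset ι → ι → ℝ`:

* `tot`  — totality with margin: `acc k P ≤ 1/3 ∨ 2/3 ≤ acc k P` for every pattern (in the wall:
  the decoy-anchor semantics makes every pattern a valid world, on which survivors are total);
* `hyb`  — the run-coupling bound: un-junking one coordinate `u` moves `acc k` by at most
  `W k P u` (own read probability of `u` plus the row term);
* `bnd`  — at every pattern at most `C` coordinates are `1/3`-heavy for each pair (in the wall:
  `C = ⌊3.2·c(t)·t⌋` from the level recursion under quadratic padding).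

From these the file proves, sorry-free: the LIGHT STEP (`soloBlind_lightStep`: un-junking a
light coordinate keeps the side), its contrapositive PIVOTAL ⇒ HEAVY (`soloBlind_pivotal_heavy`),
and the OFFLINE GREEDY LEMMA (`soloBlind_offlineGreedy`): for every touched set `T` there is a
junk set `J ⊇ T` with `#(J \ T) ≤ |κ|·C` at which every pair has the same side as at the
all-junked pattern `univ`. The proof is the greedy descent from `univ` (strong induction on
`#(P \ T)`): while some coordinate outside `T` is light for every pair, un-junk it; when stuck,
`P \ T` is covered by the `|κ|` heavy sets.
-/

namespace Summit.QuantumAdvantage.QuantumAdvantage.Theorems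

open Finset

variable {ι κ : Type*} [DecidableEq ι]

/- The *side* (rounded acceptance, language bit) of pair `k` at junk pattern `P` is written
inline as `1/2 ≤ acc k P` (HIGH); under `tot` this is the same as `≥ 2/3`, and LOW the same as
`≤ 1/3`. No definitions are introduced (Theorems files stay proposition-free). -/

/-- LIGHT STEP (the wall's (K1′)): if every pattern is total with margin (`tot`) and un-junking
`u ∈ P` moves the acceptance of pair `k` by at most `W k P u` (`hyb`), then un-junking a
coordinate whose effective weight is `< 1/3` does not change the side of `k`. -/
theorem soloBlind_lightStep
    (acc : κ → Finset ι → ℝ) (W : κ → Finset ι → ι → ℝ)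
    (tot : ∀ (k : κ) (P : Finset ι), acc k P ≤ 1 / 3 ∨ 2 / 3 ≤ acc k P)
    (hyb : ∀ (k : κ) (P : Finset ι) (u : ι), u ∈ P → |acc k P - acc k (P.erase u)| ≤ W k P u)
    {k : κ} {P : Finset ι} {u : ι} (hu : u ∈ P) (hl : W k P u < 1 / 3) :
    ((1 : ℝ) / 2 ≤ acc k P ↔ (1 : ℝ) / 2 ≤ acc k (P.erase u)) := by
  have h := hyb k P u hu
  rw [abs_le] at h
  obtain ⟨hlo, hhi⟩ := h
  have h1 := tot k P
  have h2 := tot k (P.erase u)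
  constructor
  · intro hs
    rcases h1 with h1 | h1
    · exfalso; linarith
    · rcases h2 with h2 | h2
      · exfalso; linarith
      · linarith
  · intro hs
    rcases h2 with h2 | h2
    · exfalso; linarith
    · rcases h1 with h1 | h1
      · exfalso; linarith
      · linarith

/-- PIVOTAL ⇒ HEAVY (contrapositive of the light step): if un-junking `u` flips the side of
pair `k` at `P`, then `u` carries effective weight at least `1/3` for `k` at `P`. This is the
inequality that bounds pivotal sets by heavy sets in the level recursion of the wall. -/
theorem soloBlind_pivotal_heavy
    (acc : κ → Finset ι → ℝ) (W : κ → Finset ι → ι → ℝ)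
    (tot : ∀ (k : κ) (P : Finset ι), acc k P ≤ 1 / 3 ∨ 2 / 3 ≤ acc k P)
    (hyb : ∀ (k : κ) (P : Finset ι) (u : ι), u ∈ P → |acc k P - acc k (P.erase u)| ≤ W k P u)
    {k : κ} {P : Finset ι} {u : ι} (hu : u ∈ P)
    (hpiv : ¬ ((1 : ℝ) / 2 ≤ acc k P ↔ (1 : ℝ) / 2 ≤ acc k (P.erase u))) :
    1 / 3 ≤ W k P u := by
  by_contra hlt
  push Not at hlt
  exact hpiv (soloBlind_lightStep acc W tot hyb hu hlt)

/-- OFFLINE GREEDY LEMMA (the combinatorial content of the Defeat Lemma of THEOREM H).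
Coordinates `ι` (finite), answered pairs `κ` (finite); `tot`, `hyb` as in the light step, and
`bnd`: at every pattern, each pair has at most `C` coordinates of effective weight `≥ 1/3`.
Then for every touched set `T` there is a junk set `J` with `T ⊆ J`, `#(J \ T) ≤ |κ| · C`, and
every pair has at `J` the side it has at the all-junked pattern `univ` — so answering every
`CODE` query with the side at the all-junked world is truthful at `J`, and `J` is small. -/
theorem soloBlind_offlineGreedy [Fintype ι] [Fintype κ]
    (acc : κ → Finset ι → ℝ) (W : κ → Finset ι → ι → ℝ) (C : ℕ)
    (tot : ∀ (k : κ) (P : Finset ι), acc k P ≤ 1 / 3 ∨ 2 / 3 ≤ acc k P)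
    (hyb : ∀ (k : κ) (P : Finset ι) (u : ι), u ∈ P → |acc k P - acc k (P.erase u)| ≤ W k P u)
    (bnd : ∀ (k : κ) (P : Finset ι), (P.filter (fun u => (1 : ℝ) / 3 ≤ W k P u)).card ≤ C)
    (T : Finset ι) :
    ∃ J : Finset ι, T ⊆ J ∧ (J \ T).card ≤ Fintype.card κ * C ∧
      ∀ k, ((1 : ℝ) / 2 ≤ acc k J ↔ (1 : ℝ) / 2 ≤ acc k (univ : Finset ι)) := by
  suffices h : ∀ n : ℕ, ∀ P : Finset ι, (P \ T).card = n → T ⊆ P →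
      (∀ k, ((1 : ℝ) / 2 ≤ acc k P ↔ (1 : ℝ) / 2 ≤ acc k (univ : Finset ι))) →
      ∃ J : Finset ι, T ⊆ J ∧ (J \ T).card ≤ Fintype.card κ * C ∧
        ∀ k, ((1 : ℝ) / 2 ≤ acc k J ↔ (1 : ℝ) / 2 ≤ acc k (univ : Finset ι)) by
    exact h _ univ rfl (subset_univ T) (fun k => Iff.rfl)
  intro n
  induction n using Nat.strong_induction_on with
  | _ n ih =>
    intro P hn hT hside
    by_cases hex : ∃ u ∈ P \ T, ∀ k, W k P u < 1 / 3
    · obtain ⟨u, hu, hlu⟩ := hex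
      have hu' := hu
      rw [mem_sdiff] at hu'
      have hpos : 0 < n := by
        rw [← hn]
        exact card_pos.mpr ⟨u, hu⟩
      have heq : (P.erase u) \ T = (P \ T).erase u := by
        ext x
        simp only [mem_sdiff, mem_erase]
        tauto
      have hcard : ((P.erase u) \ T).card < n := by
        rw [heq, card_erase_of_mem hu, hn]
        omega
      have hTsub : T ⊆ P.erase u := by
        intro x hx
        rw [mem_erase]
        refine ⟨?_, hT hx⟩
        intro hxu
        rw [hxu] at hx
        exact hu'.2 hx
      have hside' : ∀ k, ((1 : ℝ) / 2 ≤ acc k (P.erase u) ↔ (1 : ℝ) / 2 ≤ acc k (univ : Finset ι)) :=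
        fun k => (soloBlind_lightStep acc W tot hyb hu'.1 (hlu k)).symm.trans (hside k)
      exact ih _ hcard (P.erase u) rfl hTsub hside'
    · push Not at hex
      refine ⟨P, hT, ?_, hside⟩
      calc (P \ T).card
          ≤ ((univ : Finset κ).biUnion
              (fun k => P.filter (fun u => (1 : ℝ) / 3 ≤ W k P u))).card := by
            apply card_le_card
            intro u hu
            obtain ⟨k, hk⟩ := hex u hu
            rw [mem_biUnion]
            exact ⟨k, mem_univ k, mem_filter.mpr ⟨(mem_sdiff.mp hu).1, hk⟩⟩
        _ ≤ ∑ k, (P.filter (fun u => (1 : ℝ) / 3 ≤ W k P u)).card := card_biUnion_le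
        _ ≤ ∑ _k : κ, C := sum_le_sum (fun k _ => bnd k P)
        _ = Fintype.card κ * C := by
            simp [sum_const, smul_eq_mul, card_univ]

end Summit.QuantumAdvantage.QuantumAdvantage.Theorems
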